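import Summits.QuantumFields.BalabanUV.Beta.FP.DressedEntryWardInvariance
import Summits.QuantumFields.BalabanUV.Beta.FP.TowerNKernelIndexSymmetry

/-!
# `BalabanUV.Beta.FP.TowerFTransportWardRecord` — road «FP», binder row D1, ROUTE T, the (H5-F) option (3a) (road FINDING FP-70, journal [D1P3-G62-A2]; an2 g85 W-3 (a) ∕ W-5 (3)(4)):
# **THE END CONSUMER's TRANSPORT ROW `htr` AT STOREYS j ≥ 1 FROM THE TRUE-WEIGHT ROW, THE GAUGE LETTER AND ONE PRINTED WARD LETTER** — `dressedEntry (w j) 𝒯_j = dressedEntry (wStep Lc (j+1)) 𝒯_j`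
# for the record's composite one-loop kernel `𝒯_j = hessKer (AN R j) (VN R P j) (WN R P j)`, its index symmetry supplied BY NAME (road `TowerNKernelIndexSymmetry`)

WHY (road A-2 FINDING FP-70; an2 W-5 (3): the census line for (3a) CO-SIGNED — «four F-rows DERIVED; displayed per storey: `hgauge j` ∀ j, `hW𝒯 j` for j ≥ 1 only, the scalar `hα`»).
The END consumer `…PairingSummable.d1Tel_JcComp_nested_of_fedW_pairingCoclosed_wStep` L.364 wants `htr : ∀ j ≥ 1, hessKer (AF (j+1)) (𝒱F (j+1)) (𝒲F (j+1)) μ ν z = Lc^8 · dressedEntry (wStep Lc (j+1))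
(hessKer (AN Rt j) (VN Rt P j) (WN Rt P j)) ((Lc:ℤ)•z) μ ν`.  Under (3a) the F-family is dressed by the renormalised true weight `w j := (α j)⁻¹ • wF Lc Q ℓ sn j` (an2 PART 96∕97), and road
`TowerFTransportRowW.htr_rec_w` (p753559) gives the SAME left-hand side `= Lc^8 · dressedEntry (w j) (hessKer (AN Rt j) (VN Rt P j) (WN Rt P j)) ((Lc:ℤ)•z) μ ν` for any exponentially
localised `w` (`hwloc` = PART 97 `hwloc_mul_wF`).  THIS FILE closes the gap between the two right-hand sides for ANY left-hand side `H j μ ν z`: by road `DressedEntryWardInvariance`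
v2 (`dressedEntry_eq_of_bgrad_of_wardTransversal`) the two dressings agree given (i) `hgauge j` (the weight difference is a backward fine gradient of ONE potential per coarse source —
(J-W″), by value A2-HQF0), (ii) the printed Ward identity `WardTransversal (flipK 𝒯_j)` — NOT in the tree for the composite kernel (an2 W-5 (4): L-sized, not started before TEL2 C10 ∕
R-FP-62-WARD (W2) say by value), hence DISPLAYED as `hW𝒯 j` — and (iii) the printed symmetry `IndexSymmetric 𝒯_j`, which road `TowerNKernelIndexSymmetry.indexSymmetric_hessKer_AN` SUPPLIES;
the `AbsMoment₂` letters of the table are an2's `decays_AN ∕ vertexFamilies_VN_WN` through lit `absMoment₂_hessKer_of_decays`, that of `wStep` is lit `absMoment₂_wStep`, and the weight's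
(`hw`) is PART 97 v1.3 `absMoment₂_mul_wF` at the END (displayed here, weight-generic).

WHAT ([folklore] composition BY NAME; no `def`, no `def … : Prop`, nothing cited, 0 sorry): §1 `absMoment₂_hessKer_AN` (every storey, every channel); §2 **`dressedEntry_hessKer_AN_eq_of_gauge_of_ward`**
(one storey, every output point: `dressedEntry w 𝒯_j y a b = dressedEntry (wStep Lc (j+1)) 𝒯_j y a b` from `hgauge`, `hW𝒯`); §3 **`htr_of_gauge_of_ward`** — for ANY `H : ℕ → Fin 4 → Fin 4 → (Fin 4 → ℤ) → ℝ`
(the END: `fun j => hessKer (AF (j+1)) (𝒱F (j+1)) (𝒲F (j+1))` at the σ′-scaled dressed families) with `hHw : ∀ j ≥ 1, H j μ ν z = Lc^8 · dressedEntry (w j) 𝒯_j ((Lc:ℤ)•z) μ ν` (the END: `htr_rec_w`),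
the consumer's `htr` TEXT `∀ j ≥ 1, H j μ ν z = Lc^8 · dressedEntry (wStep Lc (j+1)) 𝒯_j ((Lc:ℤ)•z) μ ν` from the storey-indexed `hgauge` and `hW𝒯` (both for `j ≥ 1`).
WHAT THIS IS NOT: not `hgauge` nor `hW𝒯` (DISPLAYED; by value HQF0 ∕ TEL2 C10); not the anchor j = 0 (road `TowerFAnchorWardRecord`, where the Ward letter IS a tree theorem); not an
instantiation of the END; nothing of Bałaban's asserted, valued or discharged; 0 estimates; 0∕4 row-D1 binders (hW, hR, D1Tel, D1Rep); NOT (C1), NOT (T-ID), NOT D1, NEVER «G-an2-4 closed»,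
NOT BetaPertH, NOT continuum, NOT Clay.

HONEST DEPENDENCY (page 1, mandatory): continuum YM on T⁴ ⇐ BetaPertH ∧ nine spine estimates (0/9 proved); BetaPertH ⇐ (D1) ∧ (D4) ∧ CAP+tail;
G-an2-4 gates asym, D1 and NE2/3/4.  HONEST FRAMING (cell contract, verbatim): «discharging `BetaPertH` makes Bałaban's UV stability UNCONDITIONAL —
a real constructive-QFT result; it is NOT the continuum limit and NOT the Clay problem.»  ABSOLUTE RULE (cell charter, verbatim): «No internally-minted
statement may enter as a cited fact. Every hypothesis is either kernel-proved in this package or a verbatim quotation of a PUBLISHED theorem with page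
reference. The manuscript(s) under audit are NOT citable for their own disputed steps — they are the thing under adjudication; programme-internal
(2001/route/tribunal) claims are never citable.»  Road «FP» OWNER, b2b-balaban-beta-d1-p3 gen 62, 2026-08-30.  No existing file touched.
-/

noncomputable section

open scoped BigOperators

namespace Summit.QuantumFields.BalabanUV.Beta.FP.TowerFTransportWardRecord

open Literature.MathematicalPhysics.QuantumFieldTheory.Balaban1983to89
open Literature.MathematicalPhysics.QuantumFieldTheory.Balaban1983to89.Beta
open Literature.MathematicalPhysics.QuantumFieldTheory.Balaban1983to89.Beta.DecimatedMomentSummable (AbsMoment₂)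
open Literature.MathematicalPhysics.QuantumFieldTheory.Balaban1983to89.Beta.DressedMomentNormalisation (EKer dressedEntry)
open ExpKernelCalculus (hessKer)
open OneStepKernelFamily (flipK absMoment₂_hessKer_of_decays)
open HessianTelescopingKKT (wStep absMoment₂_wStep)
open PolarizationSign (WardTransversal IndexSymmetric)
open Summit.QuantumFields.BalabanUV.Beta.AxialDressingRooted (one_le_of_neZero)
open Summit.QuantumFields.BalabanUV.Beta.CompositeOneShotJetData (Roots Pins AN VN WN)
open Summit.QuantumFields.BalabanUV.Beta.NVertexSectors (decays_AN)
open Summit.QuantumFields.BalabanUV.Beta.NVertexParities (vertexFamilies_VN_WN)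
open Summit.QuantumFields.BalabanUV.Beta.FP.DressedEntryWardInvariance (dressedEntry_eq_of_bgrad_of_wardTransversal)
open Summit.QuantumFields.BalabanUV.Beta.FP.TowerNKernelIndexSymmetry (indexSymmetric_hessKer_AN)

variable {Lc : ℕ} [NeZero Lc] (R : Roots Lc) (P : Pins)

/-! ## §1 The composite one-loop kernel has absolutely summable second moments -/

/-- [folklore] `AbsMoment₂ (hessKer (AN R j) (VN R P j) (WN R P j) c e)` — lit `absMoment₂_hessKer_of_decays` fed an2 `decays_AN ∕ vertexFamilies_VN_WN` (blocking `Lc^(j+1) ≥ 1`). -/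
theorem absMoment₂_hessKer_AN (j : ℕ) (c e : Fin (3 + 1)) : AbsMoment₂ (hessKer (AN R j) (VN R P j) (WN R P j) c e) := by
  obtain ⟨Cv, Cw, δ, hδ, hV, hW⟩ := vertexFamilies_VN_WN R P j
  exact absMoment₂_hessKer_of_decays (decays_AN R j) hV hW hδ (one_le_of_neZero (Lc ^ (j + 1))) c e

/-! ## §2 One storey: the true-weight dressing equals the canonical one, given the gauge letter and the Ward letter -/

/-- [folklore] **`dressedEntry_hessKer_AN_eq_of_gauge_of_ward`** — at storey `j`, for a weight `w : EKer 4` whose difference to `wStep Lc (j+1)` is a backward fine gradient of ONE potential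
per coarse source (`hgauge`) and under the printed Ward identity of the record's composite one-loop kernel (`hW𝒯`), the kernel is dressed identically by `w` and by `wStep Lc (j+1)`
(road `dressedEntry_eq_of_bgrad_of_wardTransversal`; index symmetry by road `indexSymmetric_hessKer_AN`; moments by §1 and lit `absMoment₂_wStep`). -/
theorem dressedEntry_hessKer_AN_eq_of_gauge_of_ward (j : ℕ) (w : EKer 4) (ζ : Fin 4 → (Fin 4 → ℤ) → ℝ)
    (hw : ∀ κ l, AbsMoment₂ (w κ l)) (hζ : ∀ a, AbsMoment₂ (ζ a))
    (hgauge : ∀ (c a : Fin 4) (u : Fin 4 → ℤ), w c a u - wStep Lc (j + 1) c a u = ζ a (u - Pi.single c 1) - ζ a u)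
    (hW𝒯 : WardTransversal (flipK (hessKer (AN R j) (VN R P j) (WN R P j))))
    (y : Fin 4 → ℤ) (a b : Fin 4) :
    dressedEntry w (hessKer (AN R j) (VN R P j) (WN R P j)) y a b = dressedEntry (wStep Lc (j + 1)) (hessKer (AN R j) (VN R P j) (WN R P j)) y a b :=
  dressedEntry_eq_of_bgrad_of_wardTransversal w (wStep Lc (j + 1)) (hessKer (AN R j) (VN R P j) (WN R P j)) ζ hw
    (fun κ l => absMoment₂_wStep (Lc := Lc) (j + 1) κ l) hζ (fun c e => absMoment₂_hessKer_AN R P j c e) hgauge hW𝒯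
    (indexSymmetric_hessKer_AN R P j) y a b

/-! ## §3 The consumer's `htr` TEXT from the true-weight transport row -/

/-- [folklore] **`htr_of_gauge_of_ward` — THE END CONSUMER's TRANSPORT ROW UNDER (3a).**  For a storey-indexed weight family `w` (the END: `fun j c μ p => (α j)⁻¹ * wF Lc Q ℓ sn j c μ p`)
and ANY left-hand sides `H j` (the END: the σ′-scaled `hessKer (AF (j+1)) (𝒱F (j+1)) (𝒲F (j+1))`) satisfying the true-weight transport row `hHw` (the END: road `TowerFTransportRowW.htr_rec_w`
at `w`), the storey-indexed gauge letters `hgauge j` and Ward letters `hW𝒯 j` (`j ≥ 1`) give the consumer's `htr`: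
`∀ j ≥ 1, H j μ ν z = Lc^8 · dressedEntry (wStep Lc (j+1)) (hessKer (AN R j) (VN R P j) (WN R P j)) ((Lc:ℤ)•z) μ ν` (`…PairingSummable` L.364, `Rt := R`). -/
theorem htr_of_gauge_of_ward (w : ℕ → EKer 4) (ζ : ℕ → Fin 4 → (Fin 4 → ℤ) → ℝ)
    (hw : ∀ j κ l, AbsMoment₂ (w j κ l)) (hζ : ∀ j a, AbsMoment₂ (ζ j a))
    (hgauge : ∀ j : ℕ, 1 ≤ j → ∀ (c a : Fin 4) (u : Fin 4 → ℤ), w j c a u - wStep Lc (j + 1) c a u = ζ j a (u - Pi.single c 1) - ζ j a u)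
    (hW𝒯 : ∀ j : ℕ, 1 ≤ j → WardTransversal (flipK (hessKer (AN R j) (VN R P j) (WN R P j))))
    (H : ℕ → Fin 4 → Fin 4 → (Fin 4 → ℤ) → ℝ)
    (hHw : ∀ j : ℕ, 1 ≤ j → ∀ (μ ν : Fin 4) (z : Fin 4 → ℤ),
      H j μ ν z = (Lc : ℝ) ^ 8 * dressedEntry (w j) (hessKer (AN R j) (VN R P j) (WN R P j)) ((Lc : ℤ) • z) μ ν) :
    ∀ j : ℕ, 1 ≤ j → ∀ (μ ν : Fin 4) (z : Fin 4 → ℤ),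
      H j μ ν z = (Lc : ℝ) ^ 8 * dressedEntry (wStep Lc (j + 1)) (hessKer (AN R j) (VN R P j) (WN R P j)) ((Lc : ℤ) • z) μ ν := by
  intro j hj μ ν z
  rw [hHw j hj μ ν z, dressedEntry_hessKer_AN_eq_of_gauge_of_ward R P j (w j) (ζ j) (hw j) (hζ j) (hgauge j hj) (hW𝒯 j hj)
    ((Lc : ℤ) • z) μ ν]

end Summit.QuantumFields.BalabanUV.Beta.FP.TowerFTransportWardRecord

end
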